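import Summits.ResolutionOfSingularities.ResolutionOfSingularities.Theorems.PurelyInseparableDim4ResConeLightSlices
import Summits.ResolutionOfSingularities.ResolutionOfSingularities.Theorems.PurelyInseparableDim4ResConeLightTailThreeFive
import HarnessLib
import HarnessLib.Audit.Tags

/-!
# Purely inseparable four-folds — K2(5) WITH THE d = 3 LIGHT REGIME REMOVED: the residual packaging
# (K2(p) lane, slice B, brick K27b; cell `res-dim4-pi`)

[OURS · counted 0 · cell `res-dim4-pi` · K2(p) lane holder res-dim4-p-12 g3's brick (K27b) by signature (bus
2026-08-29 01:06Z / 01:38Z), seat res-dim4-p-3 g3.]  Bookkeeping only — NOTHING here proves K2(5), K2(p),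
`NoIsolatedTrap p p` or resolution of singularities in dimension ≥ 4 / characteristic `p`.  AI kernel work,
weaker than expert review.

res-dim4-p-2's K14 (`ResCone.noAboveFloorTrap_five_iff_lightSlices`, p682887 + p-1's K12c append): K2(5) ⟺ over
every field of characteristic 5 there is no LIGHT power-cone trap (witnessed isolated above-floor `Step0 5` chain
of constant shade `d ∈ {2, 3, 4}`, `e_G ≡ 3`, returning infinitely often to a satellite step with orders `(6, 6)`)
and no binary-cone trap (`e_G ≡ 2`).  The A∞ assembly (K16–K23, K25/K25d, K26, K24a, K27a) empties the `d = 3`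
light regime.  This file REMOVES that conjunct:
* **`noAboveFloorTrap_five_iff_residual_of (h3)`** — given that no field of characteristic 5 carries a `d = 3`
  light power-cone trap (the conclusion of res-dim4-p-2 g4's K27a `no_light_powerCone_tail_three_five`, by value),
  **K2(5) ⟺ (no `d = 2` light power-cone trap) ∧ (no `d = 4` light power-cone trap = C∞) ∧ (no binary-cone
  trap)**; the unconditional corollary is a one-line append once K27a (with K24a) is in the tree.
* `no_light_powerCone_trap_five_of_cases` — the elementary split `2 ≤ d ≤ 4 ⇒ d ∈ {2, 3, 4}` behind it.
* **`noAboveFloorTrap_five_iff_residual_of_T2 (hT2)`** — the same with `h3` DISCHARGED by res-dim4-p-2 g4's K27a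
  `ResCone.no_light_powerCone_tail_three_five_of`: the only remaining input is the (T2)-killer (res-dim4-p-1 g3's
  K24a two-slot game), taken by value in K27a's `hT2` shape quantified over all chains.
bears_on: LADDER-RESOLUTION:D157-DOOR2 (res-dim4-pi · K2(p) · slice B · K27b).  Supports
stmt-ResolutionOfSingularities-16155 (helper).
-/

set_option linter.dupNamespace false -- mandated namespace of this single-conjunct summit

noncomputable section

namespace Summit.ResolutionOfSingularities.ResolutionOfSingularities.Theorems.PIDim4

namespace ResCone

open MvPolynomial
open Literature.AlgebraicGeometry.Resolution
open Literature.AlgebraicGeometry.Resolution.CentreBlowup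
open Literature.AlgebraicGeometry.Resolution.Hauser2010
open Literature.AlgebraicGeometry.Resolution.HauserPerlega2019
open RidgeBudget (NoAboveFloorTrap)

/-- **The light power-cone slice at `p = 5` splits by shade `d ∈ {2, 3, 4}`**: if none of the three constant-shade
light traps exists over `K`, no light trap with `2 ≤ d ≤ 4` exists over `K`. [OURS · bookkeeping] [folklore] -/
theorem no_light_powerCone_trap_five_of_cases {K : Type} [Field K] [CharP K 5] [DecidableEq K]
    (h : ∀ d : ℕ, d = 2 ∨ d = 3 ∨ d = 4 →
      ¬ ∃ (c : ℕ → State K) (j : ℕ → Fin 4) (b : ℕ → Fin 4 → K),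
          (∀ e' ∈ (c 0).F.support, (c 0).r ≤ e') ∧ FreeTail.IsWitnessedChain 5 c j b ∧
          (∀ k, IsIsolated 5 (c k).F ∧ Step0 5 (c k) (c (k + 1)) ∧ ordZero (c k).F ≠ (5 : ℕ) ∧
            (c k).shade = (d : ℕ∞) ∧ Module.finrank K (resVertex (c k)) = 3) ∧
          ∀ N, ∃ k, N ≤ k ∧ FreeTail.IsSatellite j b k ∧
            ordZero (c k).F = (6 : ℕ) ∧ ordZero (c (k + 1)).F = (6 : ℕ)) :
    ¬ ∃ (c : ℕ → State K) (d : ℕ) (j : ℕ → Fin 4) (b : ℕ → Fin 4 → K), 2 ≤ d ∧ d ≤ 4 ∧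
        (∀ e' ∈ (c 0).F.support, (c 0).r ≤ e') ∧ FreeTail.IsWitnessedChain 5 c j b ∧
        (∀ k, IsIsolated 5 (c k).F ∧ Step0 5 (c k) (c (k + 1)) ∧ ordZero (c k).F ≠ (5 : ℕ) ∧
          (c k).shade = (d : ℕ∞) ∧ Module.finrank K (resVertex (c k)) = 3) ∧
        ∀ N, ∃ k, N ≤ k ∧ FreeTail.IsSatellite j b k ∧
          ordZero (c k).F = (6 : ℕ) ∧ ordZero (c (k + 1)).F = (6 : ℕ) := by
  rintro ⟨c, d, j, b, hd2, hd4, hr0, hw, hc, hN⟩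
  exact h d (by omega) ⟨c, j, b, hr0, hw, hc, hN⟩

/-- **K2(5) WITH THE d = 3 LIGHT REGIME REMOVED** (brick K27b, `_of` form): if over every field of characteristic 5
there is no `d = 3` light power-cone trap (res-dim4-p-2 g4's K27a, by value as `h3`), then
**K2(5) ⟺ (no `d = 2` light power-cone trap) ∧ (no `d = 4` light power-cone trap — C∞) ∧ (no binary-cone trap)**
over every field of characteristic 5 (K14 `noAboveFloorTrap_five_iff_lightSlices` with its `2 ≤ d ≤ 4` conjunct split
by shade). [OURS · bookkeeping] [cite: CossartJannsenSaito2020, Thm. 3.14] -/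
theorem noAboveFloorTrap_five_iff_residual_of
    (h3 : ∀ (K : Type) [Field K] [CharP K 5] [DecidableEq K],
      ¬ ∃ (c : ℕ → State K) (j : ℕ → Fin 4) (b : ℕ → Fin 4 → K),
          (∀ e' ∈ (c 0).F.support, (c 0).r ≤ e') ∧ FreeTail.IsWitnessedChain 5 c j b ∧
          (∀ k, IsIsolated 5 (c k).F ∧ Step0 5 (c k) (c (k + 1)) ∧ ordZero (c k).F ≠ (5 : ℕ) ∧
            (c k).shade = ((3 : ℕ) : ℕ∞) ∧ Module.finrank K (resVertex (c k)) = 3) ∧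
          ∀ N, ∃ k, N ≤ k ∧ FreeTail.IsSatellite j b k ∧
            ordZero (c k).F = (6 : ℕ) ∧ ordZero (c (k + 1)).F = (6 : ℕ)) :
    NoAboveFloorTrap 5 5 ↔ ∀ (K : Type) [Field K] [CharP K 5] [DecidableEq K],
      (¬ ∃ (c : ℕ → State K) (j : ℕ → Fin 4) (b : ℕ → Fin 4 → K),
          (∀ e' ∈ (c 0).F.support, (c 0).r ≤ e') ∧ FreeTail.IsWitnessedChain 5 c j b ∧
          (∀ k, IsIsolated 5 (c k).F ∧ Step0 5 (c k) (c (k + 1)) ∧ ordZero (c k).F ≠ (5 : ℕ) ∧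
            (c k).shade = ((2 : ℕ) : ℕ∞) ∧ Module.finrank K (resVertex (c k)) = 3) ∧
          ∀ N, ∃ k, N ≤ k ∧ FreeTail.IsSatellite j b k ∧
            ordZero (c k).F = (6 : ℕ) ∧ ordZero (c (k + 1)).F = (6 : ℕ)) ∧
      (¬ ∃ (c : ℕ → State K) (j : ℕ → Fin 4) (b : ℕ → Fin 4 → K),
          (∀ e' ∈ (c 0).F.support, (c 0).r ≤ e') ∧ FreeTail.IsWitnessedChain 5 c j b ∧
          (∀ k, IsIsolated 5 (c k).F ∧ Step0 5 (c k) (c (k + 1)) ∧ ordZero (c k).F ≠ (5 : ℕ) ∧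
            (c k).shade = ((4 : ℕ) : ℕ∞) ∧ Module.finrank K (resVertex (c k)) = 3) ∧
          ∀ N, ∃ k, N ≤ k ∧ FreeTail.IsSatellite j b k ∧
            ordZero (c k).F = (6 : ℕ) ∧ ordZero (c (k + 1)).F = (6 : ℕ)) ∧
      (¬ ∃ (c : ℕ → State K) (d : ℕ), 2 ≤ d ∧ d ≤ 4 ∧
          (∀ e' ∈ (c 0).F.support, (c 0).r ≤ e') ∧
          ∀ k, IsIsolated 5 (c k).F ∧ Step0 5 (c k) (c (k + 1)) ∧ ordZero (c k).F ≠ (5 : ℕ) ∧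
            (c k).shade = (d : ℕ∞) ∧ Module.finrank K (resVertex (c k)) = 2) := by
  rw [noAboveFloorTrap_five_iff_lightSlices]
  refine forall_congr' fun K => forall_congr' fun _ => forall_congr' fun _ => forall_congr' fun _ => ?_
  constructor
  · rintro ⟨hB, hC⟩
    refine ⟨?_, ?_, hC⟩
    · rintro ⟨c, j, b, hr0, hw, hc, hN⟩
      exact hB ⟨c, 2, j, b, le_rfl, by omega, hr0, hw, hc, hN⟩
    · rintro ⟨c, j, b, hr0, hw, hc, hN⟩
      exact hB ⟨c, 4, j, b, by omega, le_rfl, hr0, hw, hc, hN⟩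
  · rintro ⟨h2, h4, hC⟩
    refine ⟨no_light_powerCone_trap_five_of_cases fun d hd => ?_, hC⟩
    rcases hd with rfl | rfl | rfl
    · exact h2
    · exact h3 K
    · exact h4

/-- **K2(5) WITH THE d = 3 LIGHT REGIME REMOVED, modulo the two-slot killer only** (brick K27b ∘ K27a): if for every
witnessed isolated above-floor `Step0 5` chain of constant shade `3` and `e_G ≡ 3` (from some `k₀` on) the (T2)
configuration of the light trichotomy — one boundary letter `ν` idle for ever, every other boundary letter
stretch-born and kept — is impossible (res-dim4-p-1 g3's K24a, by value as `hT2`), then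
**K2(5) ⟺ (no `d = 2` light power-cone trap) ∧ (no `d = 4` light power-cone trap) ∧ (no binary-cone trap)**.
[OURS · bookkeeping] [cite: CossartJannsenSaito2020, Thm. 3.14] -/
theorem noAboveFloorTrap_five_iff_residual_of_T2
    (hT2 : ∀ (K : Type) [Field K] [CharP K 5] [DecidableEq K] (c : ℕ → State K) (j : ℕ → Fin 4)
      (b : ℕ → Fin 4 → K), (∀ k, IsIsolated 5 (c k).F ∧ Step0 5 (c k) (c (k + 1))) →
      FreeTail.IsWitnessedChain 5 c j b → (∀ e ∈ (c 0).F.support, (c 0).r ≤ e) →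
      (∀ k, ordZero (c k).F ≠ (5 : ℕ)) → ∀ k₀ : ℕ, (∀ k, k₀ ≤ k → (c k).shade = ((3 : ℕ) : ℕ∞)) →
      (∀ k, k₀ ≤ k → Module.finrank K (resVertex (c k)) = 3) →
      ∀ (ν : Fin 4) (k₁ : ℕ), k₀ ≤ k₁ → (∀ k, k₁ ≤ k → 1 ≤ (c k).r ν ∧ j k ≠ ν ∧ b k ν = 0) →
      (∀ k, k₁ ≤ k → ∀ i, i ≠ ν → 1 ≤ (c k).r i →
        ∃ t, k₀ ≤ t ∧ t < k ∧ j t = i ∧ ∀ m, t < m → m < k → j m ≠ i ∧ b m i = 0) → False) :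
    NoAboveFloorTrap 5 5 ↔ ∀ (K : Type) [Field K] [CharP K 5] [DecidableEq K],
      (¬ ∃ (c : ℕ → State K) (j : ℕ → Fin 4) (b : ℕ → Fin 4 → K),
          (∀ e' ∈ (c 0).F.support, (c 0).r ≤ e') ∧ FreeTail.IsWitnessedChain 5 c j b ∧
          (∀ k, IsIsolated 5 (c k).F ∧ Step0 5 (c k) (c (k + 1)) ∧ ordZero (c k).F ≠ (5 : ℕ) ∧
            (c k).shade = ((2 : ℕ) : ℕ∞) ∧ Module.finrank K (resVertex (c k)) = 3) ∧
          ∀ N, ∃ k, N ≤ k ∧ FreeTail.IsSatellite j b k ∧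
            ordZero (c k).F = (6 : ℕ) ∧ ordZero (c (k + 1)).F = (6 : ℕ)) ∧
      (¬ ∃ (c : ℕ → State K) (j : ℕ → Fin 4) (b : ℕ → Fin 4 → K),
          (∀ e' ∈ (c 0).F.support, (c 0).r ≤ e') ∧ FreeTail.IsWitnessedChain 5 c j b ∧
          (∀ k, IsIsolated 5 (c k).F ∧ Step0 5 (c k) (c (k + 1)) ∧ ordZero (c k).F ≠ (5 : ℕ) ∧
            (c k).shade = ((4 : ℕ) : ℕ∞) ∧ Module.finrank K (resVertex (c k)) = 3) ∧
          ∀ N, ∃ k, N ≤ k ∧ FreeTail.IsSatellite j b k ∧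
            ordZero (c k).F = (6 : ℕ) ∧ ordZero (c (k + 1)).F = (6 : ℕ)) ∧
      (¬ ∃ (c : ℕ → State K) (d : ℕ), 2 ≤ d ∧ d ≤ 4 ∧
          (∀ e' ∈ (c 0).F.support, (c 0).r ≤ e') ∧
          ∀ k, IsIsolated 5 (c k).F ∧ Step0 5 (c k) (c (k + 1)) ∧ ordZero (c k).F ≠ (5 : ℕ) ∧
            (c k).shade = (d : ℕ∞) ∧ Module.finrank K (resVertex (c k)) = 2) := by
  refine noAboveFloorTrap_five_iff_residual_of fun K _ _ _ => ?_
  rintro ⟨c, j, b, hr0, hw, hc, -⟩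
  exact no_light_powerCone_tail_three_five_of (k₀ := 0) (fun k => ⟨(hc k).1, (hc k).2.1⟩) hw hr0
    (fun k => (hc k).2.2.1) (fun k _ => (hc k).2.2.2.1) (fun k _ => (hc k).2.2.2.2)
    (fun ν k₁ hk₁ hidle hborn => hT2 K c j b (fun k => ⟨(hc k).1, (hc k).2.1⟩) hw hr0 (fun k => (hc k).2.2.1) 0
      (fun k _ => (hc k).2.2.2.1) (fun k _ => (hc k).2.2.2.2) ν k₁ hk₁ hidle hborn)

end ResCone

end Summit.ResolutionOfSingularities.ResolutionOfSingularities.Theorems.PIDim4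

end
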